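import Summits.Schanuel.Schanuel.Theorems.RootDecomp1KFiniteOrderCell03

/-!
# RootDecomp1KFiniteOrderCell — lens 1, generation 33 «33364 FIRST CELL» (RootDecomp1KFiniteOrderCell.lean 7ddcd064…, 1378 l) — continuation (RootDecomp1KFiniteOrderCell04): §5 ITEM 33364 decided on the moment-curve cell, binders VERBATIM (`finiteOrderLiouvilleSchanuel_momentCurveCell`, `_NW`, `_ordCurveCell`; engine = `RootDecomp1PowerLineLadder.sb_momentCurve_of_liouvilleOrder` from the landed RootDecomp1PowerLineOrder02); §6 explicit members `ℓ_F(n) = T_{7n+4}` (order 7n + 3, NOT hyper-Liouville, the item's two Diophantine hypotheses certified: `zF_in_scope_33364`, `finiteOrderLiouvilleSchanuel_at_zF(_NW)`, `ellF_certificate`); §6b placement vs lens 6's cells (`towerNumber_sq_in_logSqCell`)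

(lens-1 g33 `RootDecomp1KFiniteOrderCell.lean`, sha256 7ddcd064f55911e6…, farm rc 0 · 0 warn · 0 sorry · axioms std; critic VERDICT STATUS L1611: ONE cell-decision credit «33364 FIRST CELL» (K-R15), PORT GO LOW census lane
`--supports stmt-Schanuel-33364`; port by census-1 gen 14 in four parts RootDecomp1KFiniteOrderCell01–04 (§1 = the verbatim copy of the g32 engine DELETED, engine imported from the landed `RootDecomp1PowerLineOrder02`;
`set_option linter.*` dropped; 14 one-line docstrings added); statements and proofs verbatim; binders hNW1 / hNW by name. Nothing here proves Schanuel; rung 0.)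
-/

noncomputable section

open Complex IntermediateField Filter Polynomial

namespace Summit.Schanuel.Schanuel.Theorems.RootDecomp1KFiniteOrderCell

open Summit.Schanuel.Schanuel.Theorems.RootDecomp1KHyper
open Summit.Schanuel.Schanuel.Theorems.RootDecomp1KHyper.HyperCell
open Summit.Schanuel.Schanuel.Theorems.RootDecomp1KGeneric (LiouvilleOrder LogSqLiouville)
open Literature.NumberTheory.Transcendental (NesterenkoWaldschmidt1996_thm_5_1 NesterenkoWaldschmidt1996_thm_1)
open Summit.Schanuel.Schanuel.Theorems.RootDecomp1PowerLineLadder (sb_momentCurve_of_liouvilleOrder)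

variable {n K : ℕ}

/-! ## §5  ITEM 33364 (`FiniteOrderLiouvilleSchanuel`, A₄ᵈ) DECIDED ON THE MOMENT-CURVE CELL — binders VERBATIM

The item (route file `Theses/RootDecomp1K.lean`, decl `FiniteOrderLiouvilleSchanuel`, stmt-Schanuel-33364):
`∀ (n : ℕ) (z : Fin n → ℂ), LinearIndependent ℚ z → (∀ ω, ∃ h ≠ 0, ‖Σ hᵢzᵢ‖ < (1+Σ|hᵢ|)^{−ω}) →
(¬ ∀ m, ∃ h ≠ 0, ‖Σ hᵢzᵢ‖ < exp(−(1+Σ|hᵢ|)^m)) → n ≤ trdeg ℚ(z, e^z)`.  Below: the SAME binders with ONE line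
inserted after `LinearIndependent ℚ z` — the cell `Set.range z = Set.range (ℓ, ℓ², …, ℓᴺ)` for a real `ℓ` of
exponential order `7N + 3` (outer parameters, as lens 6's / gen 32's `ℓ`); the two Diophantine hypotheses are NOT
used by the proof (the conclusion holds outright on the cell, mod `hX`) — they are CERTIFIED at the members in §6. -/

/-- **ITEM 33364 ON THE MOMENT-CURVE CELL OF A REAL OF EXPONENTIAL ORDER `7N + 3` (every level `N`; mod `hX`).**
Binders of `Summit.Schanuel.Schanuel.Theses.RootDecomp1K.FiniteOrderLiouvilleSchanuel` VERBATIM, the cell line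
`Set.range z = Set.range (fun i : Fin N => (ℓ : ℂ) ^ ((i : ℕ) + 1)) →` inserted after `LinearIndependent ℚ z`.
Proof: `n = #range z ≤ N` (`z` is injective) and `N ≤ trdeg ℚ(range z, e^{range z})` is gen 32's
`sb_momentCurve_of_liouvilleOrder` (the Schanuel field only sees `Set.range z`). -/
theorem finiteOrderLiouvilleSchanuel_momentCurveCell (hX : ExplicitRatExpApprox) {N : ℕ} {ℓ : ℝ}
    (hℓ : LiouvilleOrder (6 * N + 1 + N + 1 + 1) ℓ) :
    ∀ (n : ℕ) (z : Fin n → ℂ), LinearIndependent ℚ z →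
      Set.range z = Set.range (fun i : Fin N => (ℓ : ℂ) ^ ((i : ℕ) + 1)) →
      (∀ ω : ℕ, ∃ h : Fin n → ℤ, h ≠ 0 ∧ ‖∑ i, (h i : ℂ) * z i‖ < 1 / (1 + ∑ i, (|h i| : ℝ)) ^ ω) →
      (¬ ∀ m : ℕ, ∃ h : Fin n → ℤ, h ≠ 0 ∧
        ‖∑ i, (h i : ℂ) * z i‖ < Real.exp (-((1 + ∑ i, (|h i| : ℝ)) ^ m))) →
      (n : Cardinal) ≤ Algebra.trdeg ℚ
        ↥(IntermediateField.adjoin ℚ (Set.range z ∪ Set.range (Complex.exp ∘ z))) := by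
  intro n z hz hrange _ _
  have e : Set.range z ∪ Set.range (Complex.exp ∘ z) =
      Set.range (fun i : Fin N => (ℓ : ℂ) ^ ((i : ℕ) + 1)) ∪
        Set.range (Complex.exp ∘ fun i : Fin N => (ℓ : ℂ) ^ ((i : ℕ) + 1)) := by
    rw [Set.range_comp, Set.range_comp, hrange]
  have hnN : (n : Cardinal) ≤ (N : Cardinal) :=
    calc (n : Cardinal) = Cardinal.mk (Fin n) := (Cardinal.mk_fin n).symm
      _ = Cardinal.mk (Set.range z) := (Cardinal.mk_range_eq z hz.injective).symm
      _ = Cardinal.mk (Set.range (fun i : Fin N => (ℓ : ℂ) ^ ((i : ℕ) + 1))) := by rw [hrange]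
      _ ≤ Cardinal.mk (Fin N) := Cardinal.mk_range_le
      _ = N := Cardinal.mk_fin N
  rw [e]
  exact hnN.trans (sb_momentCurve_of_liouvilleOrder hX N hℓ)

/-- The same, modulo the REGISTERED Literature fact `NesterenkoWaldschmidt1996_thm_5_1` only
(`explicitRatExpApprox_of_NW1996`, Hyper19). -/
theorem finiteOrderLiouvilleSchanuel_momentCurveCell_NW (hNW : NesterenkoWaldschmidt1996_thm_5_1) {N : ℕ}
    {ℓ : ℝ} (hℓ : LiouvilleOrder (6 * N + 1 + N + 1 + 1) ℓ) :
    ∀ (n : ℕ) (z : Fin n → ℂ), LinearIndependent ℚ z →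
      Set.range z = Set.range (fun i : Fin N => (ℓ : ℂ) ^ ((i : ℕ) + 1)) →
      (∀ ω : ℕ, ∃ h : Fin n → ℤ, h ≠ 0 ∧ ‖∑ i, (h i : ℂ) * z i‖ < 1 / (1 + ∑ i, (|h i| : ℝ)) ^ ω) →
      (¬ ∀ m : ℕ, ∃ h : Fin n → ℤ, h ≠ 0 ∧
        ‖∑ i, (h i : ℂ) * z i‖ < Real.exp (-((1 + ∑ i, (|h i| : ℝ)) ^ m))) →
      (n : Cardinal) ≤ Algebra.trdeg ℚ
        ↥(IntermediateField.adjoin ℚ (Set.range z ∪ Set.range (Complex.exp ∘ z))) :=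
  finiteOrderLiouvilleSchanuel_momentCurveCell (explicitRatExpApprox_of_NW1996 hNW) hℓ

/-- **The cell as ONE line at every level at once** — `z` is (a relabelling of) the moment curve of SOME real of
exponential order `7n + 3` at ITS OWN level `n` (the union over `ℓ` of the cells above): item 33364 on it, binders
verbatim, the cell line `(∃ ℓ, LiouvilleOrder (6n+1+n+1+1) ℓ ∧ Set.range z = Set.range (ℓ^(i+1))_i) →` inserted
(mod `hX`). -/
theorem finiteOrderLiouvilleSchanuel_ordCurveCell (hX : ExplicitRatExpApprox) :
    ∀ (n : ℕ) (z : Fin n → ℂ), LinearIndependent ℚ z →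
      (∃ ℓ : ℝ, LiouvilleOrder (6 * n + 1 + n + 1 + 1) ℓ ∧
        Set.range z = Set.range (fun i : Fin n => (ℓ : ℂ) ^ ((i : ℕ) + 1))) →
      (∀ ω : ℕ, ∃ h : Fin n → ℤ, h ≠ 0 ∧ ‖∑ i, (h i : ℂ) * z i‖ < 1 / (1 + ∑ i, (|h i| : ℝ)) ^ ω) →
      (¬ ∀ m : ℕ, ∃ h : Fin n → ℤ, h ≠ 0 ∧
        ‖∑ i, (h i : ℂ) * z i‖ < Real.exp (-((1 + ∑ i, (|h i| : ℝ)) ^ m))) →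
      (n : Cardinal) ≤ Algebra.trdeg ℚ
        ↥(IntermediateField.adjoin ℚ (Set.range z ∪ Set.range (Complex.exp ∘ z))) := by
  intro n z hz hcell hA hB
  obtain ⟨ℓ, hℓ, hrange⟩ := hcell
  exact finiteOrderLiouvilleSchanuel_momentCurveCell hX hℓ n z hz hrange hA hB

/-! ## §6  THE EXPLICIT MEMBERS `ℓ_F(n) = T_{7n+4}`: order `7n + 3`, NOT hyper-Liouville, and item 33364's two
Diophantine hypotheses CERTIFIED (hypothesis-free) at `z_F(n) = (ℓ_F(n), ℓ_F(n)², …, ℓ_F(n)ⁿ)`, `n ≥ 2` -/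

/-- Powers `x, x², …, xⁿ` of a transcendental number are `ℚ`-linearly independent (lens 6 gen 9, Hyper13 —
private there, copied verbatim). -/
private theorem linearIndependent_pow_succ_of_transcendental' {x : ℂ} (hx : Transcendental ℚ x) (n : ℕ) :
    LinearIndependent ℚ (fun i : Fin n => x ^ ((i : ℕ) + 1)) := by
  rw [Fintype.linearIndependent_iff]
  intro c hc i
  set f : ℚ[X] := ∑ j : Fin n, Polynomial.C (c j) * X ^ ((j : ℕ) + 1) with hf
  have hfx : aeval x f = 0 := by
    rw [hf, map_sum]
    simp only [map_mul, map_pow, aeval_C, aeval_X]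
    rw [← hc]
    refine Finset.sum_congr rfl fun j _ => ?_
    rw [Algebra.smul_def]
  have hf0 : f = 0 := by
    by_contra hne
    exact hx ⟨f, hne, hfx⟩
  have hcoef : f.coeff ((i : ℕ) + 1) = c i := by
    rw [hf, finsetSum_coeff]
    simp only [Polynomial.coeff_C_mul_X_pow]
    rw [Finset.sum_eq_single i]
    · rw [if_pos rfl]
    · intro j _ hj
      rw [if_neg]
      intro h; apply hj; exact Fin.ext (by omega)
    · intro h; exact absurd (Finset.mem_univ _) h
  rw [hf0, Polynomial.coeff_zero] at hcoef
  exact hcoef.symm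

/-- **`ℓ_F(n) := T_{7n+4}`** — the level-`n` member. -/
def ellF (n : ℕ) : ℝ := towerNumber (7 * n + 4)

/-- **`z_F(n) := (ℓ_F(n), ℓ_F(n)², …, ℓ_F(n)ⁿ)`** — the member tuple at level `n`. -/
def zF (n : ℕ) : Fin n → ℂ := fun i : Fin n => ((ellF n : ℝ) : ℂ) ^ ((i : ℕ) + 1)

/-- (i) `ℓ_F(n)` has exponential Liouville order `7n + 3` — EXACTLY the engine's hypothesis `6n+1+n+1+1`. -/
theorem liouvilleOrder_ellF (n : ℕ) : LiouvilleOrder (6 * n + 1 + n + 1 + 1) (ellF n) := by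
  rw [show 6 * n + 1 + n + 1 + 1 = 7 * n + 3 by ring]
  exact liouvilleOrder_towerNumber (7 * n + 3)

/-- (i′) … and NOT order `7n + 5`: the order is PINNED in `[7n+3, 7n+5)`. -/
theorem not_liouvilleOrder_ellF (n : ℕ) : ¬ LiouvilleOrder (7 * n + 5) (ellF n) :=
  not_liouvilleOrder_towerNumber (c := 7 * n + 4) (by omega)

/-- (ii) **`ℓ_F(n)` is NOT hyper-Liouville** (PROVED, hypothesis-free): outside item 33363's class. -/
theorem not_hyperLiouville_ellF (n : ℕ) : ¬ HyperLiouville (ellF n) :=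
  not_hyperLiouville_towerNumber (c := 7 * n + 4) (by omega)

/-- `ℓ_F(n)` is Liouville, irrational, positive, `≤ 1`, transcendental. -/
theorem liouville_ellF (n : ℕ) : Liouville (ellF n) := liouville_towerNumber (c := 7 * n + 4) (by omega)

/-- The explicit member `ℓ_F(n) = T_{7n+4}` is positive. -/
theorem ellF_pos (n : ℕ) : 0 < ellF n := towerNumber_pos (c := 7 * n + 4) (by omega)

/-- `ℓ_F(n) ≤ 1`. -/
theorem ellF_le_one (n : ℕ) : ellF n ≤ 1 := towerNumber_le_one (c := 7 * n + 4) (by omega)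

/-- `ℓ_F(n)` is transcendental (it is a Liouville number). -/
theorem transcendental_ellF (n : ℕ) : Transcendental ℚ ((ellF n : ℝ) : ℂ) :=
  transcendental_ofReal_of_liouville (liouville_ellF n)

/-- No finite order `≥ 48` and in particular NOT order `49` for `n ≤ 6`: the members at levels `2, …, 6` lie
OUTSIDE lens 6's order-`49` cells of gen 13 (`RootDecomp1KGeneric16`: `ordPair_scope`, line cells). -/
theorem not_liouvilleOrder_49_ellF {n : ℕ} (hn : n ≤ 6) : ¬ LiouvilleOrder 49 (ellF n) :=
  fun h => not_liouvilleOrder_ellF n (h.mono (by omega))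

/-- `z_F(n)` is `ℚ`-free (hypothesis-free). -/
theorem linearIndependent_zF (n : ℕ) : LinearIndependent ℚ (zF n) :=
  linearIndependent_pow_succ_of_transcendental' (transcendental_ellF n) n

/-- (iii-a) Item 33364's FIRST Diophantine hypothesis at `z_F(n)`, `n ≥ 2` — small integer linear forms to every
POLYNOMIAL order (`q·ℓ² − p·ℓ = ℓ(qℓ − p)`; tree `linLiouville_momentCurve`), hypothesis-free. -/
theorem linLiouville_zF {n : ℕ} (hn : 2 ≤ n) : LinLiouville (zF n) :=
  linLiouville_momentCurve (liouville_ellF n) hn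

/-- (iii-b) Item 33364's SECOND Diophantine hypothesis at `z_F(n)` — NO hyper-small linear forms (§4 with
`c = 7n + 4 ≥ n + 1`), hypothesis-free, every `n`. -/
theorem not_hyperLinLiouville_zF (n : ℕ) : ¬ HyperLinLiouville (zF n) :=
  not_hyperLinLiouville_momentCurve_towerNumber (c := 7 * n + 4) (n := n) (by omega) (by omega)

/-- (iv) The conclusion at `z_F(n)` (mod `hX`), every `n`: Schanuel's bound, via gen 32's finite-order engine. -/
theorem sb_zF (hX : ExplicitRatExpApprox) (n : ℕ) : SB n (zF n) :=
  sb_momentCurve_of_liouvilleOrder hX n (liouvilleOrder_ellF n)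

/-- **THE CERTIFICATE (hypothesis-free part): `z_F(n)`, `n ≥ 2`, satisfies ALL THREE hypotheses of item 33364
VERBATIM** — `ℚ`-free, small linear forms to every polynomial order, and NOT to every exponential order. -/
theorem zF_in_scope_33364 {n : ℕ} (hn : 2 ≤ n) :
    LinearIndependent ℚ (zF n) ∧
      (∀ ω : ℕ, ∃ h : Fin n → ℤ, h ≠ 0 ∧
        ‖∑ i, (h i : ℂ) * zF n i‖ < 1 / (1 + ∑ i, (|h i| : ℝ)) ^ ω) ∧
      (¬ ∀ m : ℕ, ∃ h : Fin n → ℤ, h ≠ 0 ∧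
        ‖∑ i, (h i : ℂ) * zF n i‖ < Real.exp (-((1 + ∑ i, (|h i| : ℝ)) ^ m))) :=
  ⟨linearIndependent_zF n, linLiouville_zF hn, not_hyperLinLiouville_zF n⟩

/-- **ITEM 33364's TEXT INSTANTIATED AT `z = z_F(n)`, `n ≥ 2`, with every hypothesis DISCHARGED and the
conclusion PROVED (mod `hX`)** — a decided, NON-VACUOUS instance of A₄ᵈ at every level `n ≥ 2`. -/
theorem finiteOrderLiouvilleSchanuel_at_zF (hX : ExplicitRatExpApprox) {n : ℕ} (hn : 2 ≤ n) :
    LinearIndependent ℚ (zF n) ∧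
      (∀ ω : ℕ, ∃ h : Fin n → ℤ, h ≠ 0 ∧
        ‖∑ i, (h i : ℂ) * zF n i‖ < 1 / (1 + ∑ i, (|h i| : ℝ)) ^ ω) ∧
      (¬ ∀ m : ℕ, ∃ h : Fin n → ℤ, h ≠ 0 ∧
        ‖∑ i, (h i : ℂ) * zF n i‖ < Real.exp (-((1 + ∑ i, (|h i| : ℝ)) ^ m))) ∧
      (n : Cardinal) ≤ Algebra.trdeg ℚ
        ↥(IntermediateField.adjoin ℚ (Set.range (zF n) ∪ Set.range (Complex.exp ∘ zF n))) :=
  ⟨linearIndependent_zF n, linLiouville_zF hn, not_hyperLinLiouville_zF n, sb_zF hX n⟩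

/-- Registered-fact form of the instance (mod `NesterenkoWaldschmidt1996_thm_5_1` only). -/
theorem finiteOrderLiouvilleSchanuel_at_zF_NW (hNW : NesterenkoWaldschmidt1996_thm_5_1) {n : ℕ} (hn : 2 ≤ n) :
    LinearIndependent ℚ (zF n) ∧
      (∀ ω : ℕ, ∃ h : Fin n → ℤ, h ≠ 0 ∧
        ‖∑ i, (h i : ℂ) * zF n i‖ < 1 / (1 + ∑ i, (|h i| : ℝ)) ^ ω) ∧
      (¬ ∀ m : ℕ, ∃ h : Fin n → ℤ, h ≠ 0 ∧
        ‖∑ i, (h i : ℂ) * zF n i‖ < Real.exp (-((1 + ∑ i, (|h i| : ℝ)) ^ m))) ∧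
      (n : Cardinal) ≤ Algebra.trdeg ℚ
        ↥(IntermediateField.adjoin ℚ (Set.range (zF n) ∪ Set.range (Complex.exp ∘ zF n))) :=
  finiteOrderLiouvilleSchanuel_at_zF (explicitRatExpApprox_of_NW1996 hNW) hn

/-- `z_F(n)` lies in the cell of §5 (with `ℓ = ℓ_F(n)`, `N = n`), so the cell theorems apply to it verbatim. -/
theorem zF_mem_ordCurveCell (n : ℕ) :
    ∃ ℓ : ℝ, LiouvilleOrder (6 * n + 1 + n + 1 + 1) ℓ ∧
      Set.range (zF n) = Set.range (fun i : Fin n => (ℓ : ℂ) ^ ((i : ℕ) + 1)) :=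
  ⟨ellF n, liouvilleOrder_ellF n, rfl⟩

/-! ### §6b  Honest placement of the low levels against lens 6's decided cells

* Level `2`: the pair `(ℓ, ℓ²)` for `ℓ` log-square Liouville and not hyper-Liouville is lens 6's DECIDED cell
  `logSqCell_sq_in_finiteOrder_scope` (gen 14, `RootDecomp1KGeneric19`, mod NW 1996 **Thm 1**); every real of
  exponential order `≥ 3` is log-square Liouville (`LogSqLiouville.of_liouvilleOrder`).  So at `n = 2` the CELL is
  not new (our proof is an independent one, mod Thm 5 (1) / `hX`); what is new there is the MEMBER: `T_c` is the
  first explicit real in the tree certified `LogSqLiouville ∧ ¬ HyperLiouville` — it settles the `⊊?` left open in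
  `logSq_classes_witnesses` (Generic21: «hyper-Liouville ⊊? log-square Liouville»).
* Level `3`: lens 6's gen-13 line cells need a ratio of exponential order `≥ 49` (`RootDecomp1KGeneric16`);
  `ℓ_F(3) = T_25` has order `24` and NOT `26` (`not_liouvilleOrder_49_ellF`), so `z_F(3)` is OUTSIDE them, inside
  the recorded level-3 residual; the order-`24` moment-curve cell is gen 32's engine at `n = 3`.
* Levels `n ≥ 4`: no prior cell of item 33364 in the tree. -/

/-- `T_{k+1}` (`k ≥ 3`) is log-square Liouville (order `k ≥ 3`) … -/
theorem logSqLiouville_towerNumber {k : ℕ} (hk : 3 ≤ k) : LogSqLiouville (towerNumber (k + 1)) :=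
  LogSqLiouville.of_liouvilleOrder (liouvilleOrder_towerNumber k) hk

/-- **… and NOT hyper-Liouville: an explicit witness that `HyperLiouville ⊊ LogSqLiouville`** (hypothesis-free;
answers Generic21's `⊊?`). -/
theorem hyperLiouville_ssubset_logSqLiouville_witness {k : ℕ} (hk : 3 ≤ k) :
    LogSqLiouville (towerNumber (k + 1)) ∧ ¬ HyperLiouville (towerNumber (k + 1)) :=
  ⟨logSqLiouville_towerNumber hk, not_hyperLiouville_towerNumber (by omega)⟩

/-- Level-2 placement: `(T_{k+1}, T_{k+1}²)`, `k ≥ 3`, is an EXPLICIT member of lens 6's decided log-square cell of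
item 33364 (mod NW 1996 Thm 1) — both of its Diophantine hypotheses and the conclusion, by `RootDecomp1KGeneric19`. -/
theorem towerNumber_sq_in_logSqCell (hNW1 : NesterenkoWaldschmidt1996_thm_1) {k : ℕ} (hk : 3 ≤ k) :
    LinLiouville ![((towerNumber (k + 1) : ℝ) : ℂ), ((towerNumber (k + 1) : ℝ) : ℂ) ^ 2] ∧
      ¬ HyperLinLiouville ![((towerNumber (k + 1) : ℝ) : ℂ), ((towerNumber (k + 1) : ℝ) : ℂ) ^ 2] ∧
      SB 2 ![((towerNumber (k + 1) : ℝ) : ℂ), ((towerNumber (k + 1) : ℝ) : ℂ) ^ 2] :=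
  Summit.Schanuel.Schanuel.Theorems.RootDecomp1KGeneric.logSqCell_sq_in_finiteOrder_scope hNW1
    (logSqLiouville_towerNumber hk) (not_hyperLiouville_towerNumber (by omega))

/-- Summary of the member family (hypothesis-free facts), every `n`: order pinned, not hyper-Liouville, `ℚ`-free
moment curve with NO hyper-small linear forms; plus small forms to every polynomial order once `n ≥ 2`. -/
theorem ellF_certificate (n : ℕ) :
    LiouvilleOrder (7 * n + 3) (ellF n) ∧ ¬ LiouvilleOrder (7 * n + 5) (ellF n) ∧ Liouville (ellF n) ∧
      ¬ HyperLiouville (ellF n) ∧ LinearIndependent ℚ (zF n) ∧ ¬ HyperLinLiouville (zF n) ∧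
      (2 ≤ n → LinLiouville (zF n)) :=
  ⟨liouvilleOrder_towerNumber (7 * n + 3), not_liouvilleOrder_ellF n, liouville_ellF n, not_hyperLiouville_ellF n,
    linearIndependent_zF n, not_hyperLinLiouville_zF n, fun hn => linLiouville_zF hn⟩

end Summit.Schanuel.Schanuel.Theorems.RootDecomp1KFiniteOrderCell
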